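import Literature.NumberTheory.GaloisRepresentations.KummerKeyStep
import Literature.NumberTheory.GaloisRepresentations.KummerIdeleIndex
import Literature.NumberTheory.GaloisRepresentations.GlobalReciprocityKeyLemmaReductionProofs
import HarnessLib

/-!
# The global reciprocity map exists: `exists_isGlobalReciprocityMap_holds`

This file discharges the named fact `exists_isGlobalReciprocityMap` of `GlobalReciprocity.lean`
(for number fields `K : Type`, the universe of the tree's idele class group API): there is a
continuous surjective homomorphism `θ : C_K = 𝕀_K/Kˣ → Gal(K^ab/K)` sending local units to inertia
and uniformizers to Frobenius at the unramified places (`IsGlobalReciprocityMap`).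

## The road (Neukirch, *Class Field Theory — The Bonn Lectures*, Part III §§6–7; Tate,
Cassels–Fröhlich Ch. VII §§9–12)

The tree already contains the reciprocity law for finite abelian layers
(`artinReciprocity_character_holds`: every character `χ` of `Gal(L/K)` gives a finite-order Hecke
character `ω_χ = χ ∘ ψ_{L|K}` with the right Frobenius values) and the reduction of the global
map to the **existence theorem in character form** ("every finite-order Hecke character is some
`ω_χ`", `GlobalReciprocityCharacterFormProofs`, `GlobalReciprocityRatProofs`), further reduced by
cyclic descent along `K(μ_{4p})/K` and induction on the order
(`GlobalReciprocityCyclicDescentProofs`, `GlobalReciprocityKeyLemmaReductionProofs`: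
`exists_isGlobalReciprocityMap_of_keyLemma`) to the

**Key Lemma** (`exists_cyclic_charHecke_of_pow_prime_eq_one`, Tate §12 / Neukirch (7.7)–(7.8)):
over a totally complex `F ∋ μ_p`,
every Hecke character `η` with `ηᵖ = 1` is `ω_χ` for a character `χ` of a cyclic Kummer extension
`F(ᵖ√a)/F`.

Its proof here follows Neukirch's proof of Theorem (7.7) (p. 177), with norm groups replaced by
kernels of Hecke characters:

1. `map_powMonoidHom_sup_unitIdelesOutside_inf_map_unit` — the key step
   `(𝕀^T)ᵖ U^T ∩ Fˣ = (F^T)ᵖ` (`KummerKeyStep.exists_pow_eq_of_local_pow_of_unit`, which uses the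
   reciprocity law exactly where Neukirch does);
2. `index_principalIdeles_sup_powUnitIdeles` — the index computation
   `(𝕀_F : Fˣ (𝕀^T)ᵖ U^T) = (𝕀^T : (𝕀^T)ᵖ U^T)/(F^T : (F^T)ᵖ) · … = (F^T : (F^T)ᵖ) = p^{r₂+|T|}`
   (local indices `LocalPowerClassIndex` = Neukirch II (5.8), `KummerIdeleIndex` for the idelic and
   `S`-unit counts, Dirichlet's `S`-unit theorem);
3. `exists_eq_charHecke_of_forall_mem_sup` — the Kummer characters `ω_a`, `a ∈ F^T`
   (`KummerCharacters`) kill `W = Fˣ (𝕀^T)ᵖ U^T` and `ω_a = ω_b ⟹ a ≡ b (mod (F^T)ᵖ)`, so by the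
   count every character killing `W` is an `ω_a` (Neukirch's "`N_{L|K} C_L = C_K^n Ū_K^S` for
   `L = K(ⁿ√(K^S))`", dualised);
4. `exists_cyclic_charHecke_of_pow_prime_eq_one` (Key Lemma) — given `η`, enlarge `T` until
   `U^T ⊆ ker η` (`ker η` is open), so `η` kills `W`;
5. `exists_isGlobalReciprocityMap_holds`.

## References

* [Neukirch2013] J. Neukirch, *Class Field Theory — The Bonn Lectures*, ed. A. Schmidt, Springer
  2013, Part III §6 Thm. (6.6), §7 Thm. (7.7) (proof, p. 177), Thm. (7.8), Thm. (7.12).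
* [CasselsFrohlichANT1967] J. Tate, *Global class field theory*, Ch. VII of Cassels–Fröhlich,
  *Algebraic Number Theory* (1967), §5.1 Main Theorem, §9 (9.1–9.5), §12 (Key Lemma and proof of
  the existence theorem).
* [NeukirchANT1999] J. Neukirch, *Algebraic Number Theory*, Springer 1999, Ch. VI §6 (global class
  field theory via Kummer theory).
-/

noncomputable section

open scoped Pointwise IntermediateField NumberField
open NumberField IsDedekindDomain IntermediateField Field Filter
open Literature.NumberTheory.QuadraticForms Literature.NumberTheory.QuadraticForms.OMeara65

namespace Literature.NumberTheory.GaloisRepresentations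

section Count

variable {F : Type} [Field F] [NumberField F]

/-- The modular law for `B ≤ I^T`: `(P ⊔ B) ⊓ I^T = (P ⊓ I^T) ⊔ B`. [folklore] -/
theorem principalIdeles_sup_inf_sIdeles_of_le {T : Finset (HeightOneSpectrum (𝓞 F))}
    {B : Subgroup (ideleGroup F)} (hB : B ≤ sIdeles F T) :
    (principalIdeles F ⊔ B) ⊓ sIdeles F T = (principalIdeles F ⊓ sIdeles F T) ⊔ B := by
  apply le_antisymm
  · rintro x ⟨hx, hxA⟩
    obtain ⟨p, hp, c, hc, rfl⟩ := Subgroup.mem_sup.1 hx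
    have hpA : p ∈ sIdeles F T := by
      have : p = p * c * c⁻¹ := by rw [mul_inv_cancel_right]
      rw [this]
      exact (sIdeles F T).mul_mem hxA ((sIdeles F T).inv_mem (hB hc))
    exact Subgroup.mem_sup.2 ⟨p, ⟨hp, hpA⟩, c, hc, rfl⟩
  · exact sup_le (fun x hx ↦ ⟨Subgroup.mem_sup_left hx.1, hx.2⟩)
      (fun x hx ↦ ⟨Subgroup.mem_sup_right hx, hB hx⟩)

/-- **Neukirch's key step `(I_K^S)ⁿ U_K^S ∩ K^× = (K^S)ⁿ`** (in `𝕀_K`, with `K^S` embedded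
principally): for `F` totally complex containing `μ_n` and `T` admissible containing the places
above `n`, `((I^T)ⁿ U^T) ∩ ι(𝔲) = ι(𝔲ⁿ)` where `𝔲 = F^T` are the `T`-units.  The inclusion `⊆` is
`KummerKeyStep.exists_pow_eq_of_local_pow_of_unit` (the reciprocity law), `⊇` is trivial.
[cite: Neukirch2013, Part III §7 proof of Thm. (7.7), p. 177] -/
theorem map_powMonoidHom_sup_unitIdelesOutside_inf_map_unit (hR : artinReciprocity_character)
    {n : ℕ} (hn : 0 < n) {ζ : F} (hζ : IsPrimitiveRoot ζ n)
    (hcomplex : ∀ w : InfinitePlace F, w.IsComplex) {T : Finset (HeightOneSpectrum (𝓞 F))}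
    (hT : IsAdmissible F T)
    (hTn : ∀ v : HeightOneSpectrum (𝓞 F), ((n : ℕ) : 𝓞 F) ∈ v.asIdeal → v ∈ T) :
    ((sIdeles F T).map (powMonoidHom n) ⊔ unitIdelesOutside F T) ⊓
        (((↑T : Set (HeightOneSpectrum (𝓞 F))).unit F).map
          (Units.map (algebraMap F (AdeleRing (𝓞 F) F) : F →* AdeleRing (𝓞 F) F))) =
      ((((↑T : Set (HeightOneSpectrum (𝓞 F))).unit F).map (powMonoidHom n)).map
        (Units.map (algebraMap F (AdeleRing (𝓞 F) F) : F →* AdeleRing (𝓞 F) F))) := by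
  classical
  set 𝔲 : Subgroup Fˣ := (↑T : Set (HeightOneSpectrum (𝓞 F))).unit F with h𝔲
  set ι : Fˣ →* ideleGroup F :=
    Units.map (algebraMap F (AdeleRing (𝓞 F) F) : F →* AdeleRing (𝓞 F) F) with hι
  apply le_antisymm
  · rintro x ⟨hxB, hxu⟩
    obtain ⟨b, hb, rfl⟩ := Subgroup.mem_map.mp hxu
    obtain ⟨-, hf, -⟩ := mem_map_powMonoidHom_sup_unitIdelesOutside_iff.mp hxB
    -- `b` is a local `n`-th power at the places of `T`
    have hloc : ∀ v ∈ T, ∃ c : v.adicCompletion F,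
        algebraMap F (v.adicCompletion F) (b : F) = c ^ n := by
      intro v hv
      obtain ⟨t, ht⟩ := hf v hv
      refine ⟨(t : v.adicCompletion F), ?_⟩
      have h := congrArg (fun u : (v.adicCompletion F)ˣ => (u : v.adicCompletion F)) ht
      simp only [powMonoidHom_apply, Units.val_pow_eq_pow_val, hι, ideleFiniteComponent_principal,
        Units.coe_map, MonoidHom.coe_coe] at h
      exact h.symm
    have hunit : ∀ v ∉ T, v.valuation F (b : F) = 1 := fun v hv => hb v hv
    obtain ⟨c, hc⟩ :=
      exists_pow_eq_of_local_pow_of_unit hR hn hζ hcomplex hT hTn b.ne_zero hunit hloc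
    have hc0 : c ≠ 0 := by
      rintro rfl
      rw [zero_pow hn.ne'] at hc
      exact b.ne_zero hc
    have hbc : b = (Units.mk0 c hc0) ^ n :=
      Units.ext (by rw [Units.val_pow_eq_pow_val, Units.val_mk0]; exact hc)
    have hcu : Units.mk0 c hc0 ∈ 𝔲 := by
      intro v hv
      have h1 : v.valuation F (b : F) = 1 := hb v hv
      rw [hc, map_pow] at h1
      exact (pow_eq_one_iff_of_nonneg zero_le hn.ne').mp h1
    refine Subgroup.mem_map.mpr ⟨(Units.mk0 c hc0) ^ n,
      Subgroup.mem_map.mpr ⟨Units.mk0 c hc0, hcu, rfl⟩, ?_⟩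
    rw [hbc]
  · rintro x hx
    obtain ⟨y, hy, rfl⟩ := Subgroup.mem_map.mp hx
    obtain ⟨c, hc, rfl⟩ := Subgroup.mem_map.mp hy
    have hιc : ι c ∈ principalIdeles F ⊓ sIdeles F T := by
      rw [principalIdeles_inf_sIdeles]
      exact Subgroup.mem_map.mpr ⟨c, hc, rfl⟩
    refine ⟨?_, Subgroup.mem_map.mpr ⟨c ^ n, 𝔲.pow_mem hc n, ?_⟩⟩
    · rw [powMonoidHom_apply, map_pow]
      exact Subgroup.mem_sup_left (Subgroup.mem_map.mpr ⟨ι c, hιc.2, rfl⟩)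
    · rw [powMonoidHom_apply]

/-- **Neukirch's index computation** `(C_K : C_K^n Ū_K^S) = (I_K^S : (I_K^S)ⁿ U_K^S) / (K^S : (K^S)ⁿ)
= n^{2|S|} / n^{|S|}`, in the tree's normalisation and in the form needed here: for `F` totally
complex containing `μ_n`, `T` admissible (`𝕀_F = Fˣ 𝕀_F^T`) containing the places above `n`,
and `W = Fˣ · (𝕀_F^T)ⁿ U_F^T`,
`(𝕀_F : W) = (F^T : (F^T)ⁿ) = n ^ (#S_∞ + |T|)`
(`(𝕀_F : W) = ((𝕀^T)ⁿU^T · ι𝔲 : 𝕀^T)`-relative, `(𝕀^T : (𝕀^T)ⁿ U^T) = n^{2|T|+[F:ℚ]}`,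
`((𝕀^T)ⁿU^T ∩ ι𝔲 : ι𝔲) = (𝔲 : 𝔲ⁿ) = n^{r₂+|T|}` by the key step and Dirichlet, `[F:ℚ] = 2r₂`).
[cite: Neukirch2013, Part III §7 proof of Thm. (7.7), p. 177] -/
theorem index_principalIdeles_sup_powUnitIdeles (hR : artinReciprocity_character)
    {n : ℕ} (hn : 0 < n) {ζ : F} (hζ : IsPrimitiveRoot ζ n)
    (hcomplex : ∀ w : InfinitePlace F, w.IsComplex) {T : Finset (HeightOneSpectrum (𝓞 F))}
    (hT : IsAdmissible F T)
    (hTn : ∀ v : HeightOneSpectrum (𝓞 F), ((n : ℕ) : 𝓞 F) ∈ v.asIdeal → v ∈ T) :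
    (principalIdeles F ⊔ ((sIdeles F T).map (powMonoidHom n) ⊔ unitIdelesOutside F T)).index =
        (powMonoidHom n : (↑T : Set (HeightOneSpectrum (𝓞 F))).unit F →*
          (↑T : Set (HeightOneSpectrum (𝓞 F))).unit F).range.index ∧
      (powMonoidHom n : (↑T : Set (HeightOneSpectrum (𝓞 F))).unit F →*
          (↑T : Set (HeightOneSpectrum (𝓞 F))).unit F).range.index =
        n ^ (Fintype.card (InfinitePlace F) + T.card) := by
  classical
  set P := principalIdeles F with hP
  set A := sIdeles F T with hA
  set B := (sIdeles F T).map (powMonoidHom n) ⊔ unitIdelesOutside F T with hB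
  set 𝔲 : Subgroup Fˣ := (↑T : Set (HeightOneSpectrum (𝓞 F))).unit F with h𝔲
  have hBA : B ≤ A := map_powMonoidHom_sup_unitIdelesOutside_le F T
  have htop : P ⊔ A = ⊤ := hT
  -- (i) `(𝕀 : P ⊔ B) = ((P ⊓ A) ⊔ B : A)`-relative index
  have h1 : (P ⊔ B).index = ((P ⊓ A) ⊔ B).relIndex A := by
    rw [← Subgroup.relIndex_top_right, ← htop]
    have hsup : P ⊔ A = (P ⊔ B) ⊔ A :=
      le_antisymm (sup_le (le_sup_left.trans le_sup_left) le_sup_right)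
        (sup_le (sup_le le_sup_left (hBA.trans le_sup_right)) le_sup_right)
    rw [hsup, Subgroup.relIndex_sup_left, ← Subgroup.inf_relIndex_right,
      principalIdeles_sup_inf_sIdeles_of_le hBA]
  -- (ii) `(A : B) = (P ⊓ A : B ⊓ (P ⊓ A)) · ((P ⊓ A) ⊔ B : A)`
  have h2 : B.relIndex A = (B ⊓ (P ⊓ A)).relIndex (P ⊓ A) * ((P ⊓ A) ⊔ B).relIndex A := by
    rw [← Subgroup.relIndex_mul_relIndex B ((P ⊓ A) ⊔ B) A le_sup_right
      (sup_le inf_le_right hBA), Subgroup.relIndex_sup_right, Subgroup.inf_relIndex_right]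
  -- (iii) `(P ⊓ A : B ⊓ (P ⊓ A)) = (𝔲 : 𝔲ⁿ)` (key step)
  have h3 : (B ⊓ (P ⊓ A)).relIndex (P ⊓ A) = (powMonoidHom n : 𝔲 →* 𝔲).range.index := by
    rw [hP, hA, principalIdeles_inf_sIdeles, hB,
      map_powMonoidHom_sup_unitIdelesOutside_inf_map_unit hR hn hζ hcomplex hT hTn,
      Subgroup.relIndex_map_map_of_injective _ _ (unitsMap_algebraMap_adeleRing_injective F),
      relIndex_map_powMonoidHom_eq_index]
  -- (iv) the numbers
  haveI : NeZero n := ⟨hn.ne'⟩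
  haveI : Finite (↑(↑T : Set (HeightOneSpectrum (𝓞 F)))) := (Finset.finite_toSet T).to_subtype
  have hr : 1 ≤ Fintype.card (InfinitePlace F) := Fintype.card_pos
  have hreal : NumberField.InfinitePlace.nrRealPlaces F = 0 := by
    rw [NumberField.InfinitePlace.nrRealPlaces, Fintype.card_eq_zero_iff]
    exact ⟨fun w => (InfinitePlace.not_isReal_iff_isComplex.mpr (hcomplex w.1)) w.2⟩
  have hdeg : Module.finrank ℚ F = 2 * Fintype.card (InfinitePlace F) := by
    have e1 := NumberField.InfinitePlace.card_eq_nrRealPlaces_add_nrComplexPlaces (K := F)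
    have e2 := NumberField.InfinitePlace.card_add_two_mul_card_eq_rank (K := F)
    omega
  have h5 : (powMonoidHom n : 𝔲 →* 𝔲).range.index =
      n ^ (Fintype.card (InfinitePlace F) + T.card) := by
    rw [h𝔲, index_range_powMonoidHom_sUnit_of_isPrimitiveRoot _ hζ, Units.rank,
      Nat.card_coe_set_eq, Set.ncard_coe_finset]
    congr 1
    omega
  have h4 : B.relIndex A = n ^ (Fintype.card (InfinitePlace F) + T.card) *
      n ^ (Fintype.card (InfinitePlace F) + T.card) := by
    rw [hB, hA, relIndex_map_powMonoidHom_sup_unitIdelesOutside_eq F hn hζ hcomplex hTn, hdeg]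
    ring
  rw [h3, h5, h4] at h2
  have hX : ((P ⊓ A) ⊔ B).relIndex A = n ^ (Fintype.card (InfinitePlace F) + T.card) :=
    (Nat.eq_of_mul_eq_mul_left (pow_pos hn _) h2).symm
  exact ⟨by rw [h1, hX, h5], h5⟩

/-- **The Kummer characters exhaust the characters of `𝕀_F / Fˣ (𝕀^T)ⁿ U^T`** (the heart of the
existence theorem, Neukirch (7.7) "`N_{L|K} C_L = C_K^n Ū_K^S` for `L = K(ⁿ√(K^S))`", in character
form).  For `F` totally complex with `μ_n ⊆ F`, `T` admissible containing the places above `n`: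
every Hecke character `ω` of `F` trivial on `W = Fˣ (𝕀^T)ⁿ U^T` is the Hecke character
`χ ∘ ψ_{F(ⁿ√a)|F}` of a Kummer character of some `F(ⁿ√a)`, `a` a `T`-unit.  Proof: the characters
`ω_a` (`a ∈ 𝔲 = F^T`) kill `W` (`ω_aⁿ = 1`, unramified off `T`, principal ideles) and
`ω_a = ω_b ⟹ a ≡ b mod 𝔲ⁿ` (Kummer theory + key step), so `a ↦ ω_a` injects `𝔲/𝔲ⁿ` into the
`≤ (𝕀 : W)` characters killing `W`; since `(𝕀 : W) = (𝔲 : 𝔲ⁿ)` it is onto.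
[cite: Neukirch2013, Part III §7 Thm. (7.7) and its proof, pp. 176–177]
[cite: CasselsFrohlichANT1967, Ch. VII §9.5 and §12 Key Lemma] -/
theorem exists_eq_charHecke_of_forall_mem_sup (hR : artinReciprocity_character)
    (ι : AlgebraicClosure F →+* ℂ) {n : ℕ} (hn : 0 < n) {ζ : F} (hζ : IsPrimitiveRoot ζ n)
    (hcomplex : ∀ w : InfinitePlace F, w.IsComplex) {T : Finset (HeightOneSpectrum (𝓞 F))}
    (hT : IsAdmissible F T)
    (hTn : ∀ v : HeightOneSpectrum (𝓞 F), ((n : ℕ) : 𝓞 F) ∈ v.asIdeal → v ∈ T)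
    (ω : HeckeCharacter F)
    (hω : ∀ x ∈ principalIdeles F ⊔ ((sIdeles F T).map (powMonoidHom n) ⊔ unitIdelesOutside F T),
      ω x = 1) :
    ∃ (a : F) (ha : a ≠ 0) (α : AlgebraicClosure F) (hα : α ^ n = algebraMap F (AlgebraicClosure F) a)
      (χ : (F⟮α⟯ ≃ₐ[F] F⟮α⟯) →* ℂˣ),
      (∀ g, ((χ g : ℂˣ) : ℂ) * ι α = ι ((g (AdjoinSimple.gen F α) : F⟮α⟯) : AlgebraicClosure F)) ∧
      (haveI := KummerCharacter.finiteDimensional_adjoin hn hα;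
       haveI := KummerCharacter.isGalois_adjoin hn hζ ha hα;
       ω = charHecke F⟮α⟯ χ hR) := by
  classical
  set W := principalIdeles F ⊔ ((sIdeles F T).map (powMonoidHom n) ⊔ unitIdelesOutside F T)
    with hW
  set 𝔲 : Subgroup Fˣ := (↑T : Set (HeightOneSpectrum (𝓞 F))).unit F with h𝔲
  obtain ⟨hidx, hpow⟩ := index_principalIdeles_sup_powUnitIdeles hR hn hζ hcomplex hT hTn
  -- `W` has finite index
  have hidx0 : W.index ≠ 0 := by
    rw [hW, hidx, hpow]; exact pow_ne_zero _ hn.ne'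
  haveI : W.FiniteIndex := ⟨hidx0⟩
  haveI : Finite (ideleGroup F ⧸ W) := Subgroup.finite_quotient_of_finiteIndex
  haveI := hasEnoughRootsOfUnity_exponent_of_finite (ideleGroup F ⧸ W)
  -- the characters killing `W` inject into the (finite) dual of `𝕀/W`
  let X := {ω' : HeckeCharacter F // ∀ x ∈ W, ω' x = 1}
  let f : X → ((ideleGroup F ⧸ W) →* ℂˣ) := fun ω' =>
    QuotientGroup.lift W (ω'.1 : ideleGroup F →* ℂˣ) fun x hx => by
      rw [MonoidHom.mem_ker]
      exact ω'.2 x hx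
  have hf : Function.Injective f := by
    rintro ⟨ω₁, h₁⟩ ⟨ω₂, h₂⟩ h
    refine Subtype.ext (HeckeCharacter.ext fun x => ?_)
    have := DFunLike.congr_fun h (QuotientGroup.mk x)
    simpa [f] using this
  have hXcard : Nat.card X ≤ W.index :=
    calc Nat.card X ≤ Nat.card ((ideleGroup F ⧸ W) →* ℂˣ) := Nat.card_le_card_of_injective f hf
      _ = Nat.card (ideleGroup F ⧸ W) :=
          CommGroup.card_monoidHom_of_hasEnoughRootsOfUnity (ideleGroup F ⧸ W) ℂ
      _ = W.index := (Subgroup.index_eq_card W).symm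
  haveI : Finite X := by
    haveI : Finite ((ideleGroup F ⧸ W) →* ℂˣ) := Finite.of_equiv _
      (CommGroup.monoidHom_mulEquiv_of_hasEnoughRootsOfUnity (ideleGroup F ⧸ W) ℂ).some.symm.toEquiv
    exact Finite.of_injective f hf
  -- Kummer data `α_a`, `χ_a` for each `T`-unit `a`
  have ha0 : ∀ a : 𝔲, ((a : Fˣ) : F) ≠ 0 := fun a => (a : Fˣ).ne_zero
  have hroot : ∀ a : 𝔲, ∃ α : AlgebraicClosure F,
      α ^ n = algebraMap F (AlgebraicClosure F) ((a : Fˣ) : F) :=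
    fun a => IsAlgClosed.exists_pow_nat_eq _ hn
  choose α hα using hroot
  have hchar : ∀ a : 𝔲, ∃ χ : (F⟮α a⟯ ≃ₐ[F] F⟮α a⟯) →* ℂˣ, ∀ g,
      ((χ g : ℂˣ) : ℂ) * ι (α a) = ι ((g (AdjoinSimple.gen F (α a)) : F⟮α a⟯) : AlgebraicClosure F) :=
    fun a => KummerCharacter.exists_character ι hn hζ (ha0 a) (hα a)
  choose χ hχ using hchar
  haveI hFD : ∀ a : 𝔲, FiniteDimensional F F⟮α a⟯ := fun a =>
    KummerCharacter.finiteDimensional_adjoin hn (hα a)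
  haveI hGal : ∀ a : 𝔲, IsGalois F F⟮α a⟯ := fun a =>
    KummerCharacter.isGalois_adjoin hn hζ (ha0 a) (hα a)
  -- the Hecke characters `ω_a` kill `W`
  have hΩW : ∀ a : 𝔲, ∀ x ∈ W, charHecke F⟮α a⟯ (χ a) hR x = 1 := by
    intro a x hx
    obtain ⟨p, hp, b, hb, rfl⟩ := Subgroup.mem_sup.mp hx
    obtain ⟨y, hy, u, hu, rfl⟩ := Subgroup.mem_sup.mp hb
    obtain ⟨z, -, rfl⟩ := Subgroup.mem_map.mp hy
    have hΩp : charHecke F⟮α a⟯ (χ a) hR p = 1 := (charHecke F⟮α a⟯ (χ a) hR).map_principal hp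
    have hΩz : charHecke F⟮α a⟯ (χ a) hR (powMonoidHom n z) = 1 := by
      rw [powMonoidHom_apply, map_pow, ← HeckeCharacter.pow_apply,
        KummerCharacter.charHecke_pow_eq_one ι hR hn hζ (ha0 a) (hα a) (hχ a),
        HeckeCharacter.one_apply]
    have hΩu : charHecke F⟮α a⟯ (χ a) hR u = 1 :=
      HeckeCharacter.eq_one_of_isUnramifiedAt_of_units
        (S := (↑T : Set (HeightOneSpectrum (𝓞 F))))
        (fun v hv => KummerCharacter.charHecke_isUnramifiedAt hR hn hζ (ha0 a) (hα a) (χ a) v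
          (a.2 v hv) (fun hmem => hv (hTn v hmem)))
        u hu.1 (fun v hv => hu.2.1 v hv) hu.2.2
    rw [map_mul, map_mul, hΩp, hΩz, hΩu, one_mul, one_mul]
  -- `ω_a = ω_b ⟹ a ≡ b (mod 𝔲ⁿ)` (Kummer theory and the key step, via L6)
  set Rn : Subgroup 𝔲 := (powMonoidHom n : 𝔲 →* 𝔲).range with hRn
  have hinj : ∀ a b : 𝔲, charHecke F⟮α a⟯ (χ a) hR = charHecke F⟮α b⟯ (χ b) hR →
      (QuotientGroup.mk a : 𝔲 ⧸ Rn) = QuotientGroup.mk b := by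
    intro a b hab
    obtain ⟨c, hc⟩ := KummerCharacter.eq_mul_pow_of_charHecke_eq ι hR hn hζ (ha0 a) (ha0 b)
      (hα a) (hα b) (hχ a) (hχ b) hab
    have hc0 : c ≠ 0 := by
      rintro rfl
      rw [zero_pow hn.ne', mul_zero] at hc
      exact ha0 a hc
    have hcu : Units.mk0 c hc0 ∈ 𝔲 := by
      intro v hv
      have h1 : v.valuation F ((a : Fˣ) : F) = 1 := a.2 v hv
      have h2 : v.valuation F ((b : Fˣ) : F) = 1 := b.2 v hv
      rw [hc, map_mul, map_pow, h2, one_mul] at h1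
      exact (pow_eq_one_iff_of_nonneg zero_le hn.ne').mp h1
    have hab' : (a : Fˣ) = b * (Units.mk0 c hc0) ^ n :=
      Units.ext (by rw [Units.val_mul, Units.val_pow_eq_pow_val, Units.val_mk0]; exact hc)
    rw [QuotientGroup.eq]
    refine ⟨⟨Units.mk0 c hc0, hcu⟩⁻¹, Subtype.ext ?_⟩
    simp only [powMonoidHom_apply, inv_pow, Subgroup.coe_inv, Subgroup.coe_pow, Subgroup.coe_mul]
    rw [hab', mul_inv_rev, inv_mul_cancel_right]
  -- `a ↦ ω_a` on representatives of `𝔲/𝔲ⁿ` is injective into the characters killing `W` …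
  let g : 𝔲 ⧸ Rn → X := fun q => ⟨charHecke F⟮α q.out⟯ (χ q.out) hR, hΩW q.out⟩
  have hg : Function.Injective g := by
    intro q₁ q₂ h
    have h' : charHecke F⟮α q₁.out⟯ (χ q₁.out) hR = charHecke F⟮α q₂.out⟯ (χ q₂.out) hR :=
      congrArg Subtype.val h
    rw [← QuotientGroup.out_eq' q₁, ← QuotientGroup.out_eq' q₂]
    exact hinj _ _ h'
  -- … hence bijective, as `#(𝔲/𝔲ⁿ) = (𝕀 : W) ≥ #X`
  have hcardU : Nat.card (𝔲 ⧸ Rn) = W.index := by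
    rw [hW, hidx]
    exact (Subgroup.index_eq_card Rn).symm
  have hbij : Function.Bijective g :=
    hg.bijective_of_nat_card_le (by rw [hcardU]; exact hXcard)
  obtain ⟨q, hq⟩ := hbij.2 ⟨ω, hω⟩
  exact ⟨((q.out : 𝔲) : Fˣ), ha0 _, α q.out, hα _, χ q.out, hχ _, (congrArg Subtype.val hq).symm⟩

end Count

/-! ### The Key Lemma and the global reciprocity map -/

/-- **Key Lemma** (Tate, Cassels–Fröhlich Ch. VII §12; Neukirch III (7.7) ⟹ (7.8) existence
theorem, in character form): over a totally complex number field `F` containing the `p`-th roots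
of unity (`p` prime), every Hecke character `η` with `η ^ p = 1` is the Hecke character
`χ ∘ ψ_{L|F}` of a character `χ` of a finite cyclic (Kummer) extension `L = F(ᵖ√a)`.  Proof:
choose `T` admissible, containing the places above `p`, and so large that `ker η ⊇ U_F^T`
(`ker η` is open); then `η` kills `W = Fˣ (𝕀^T)ᵖ U^T` and `exists_eq_charHecke_of_forall_mem_sup`
applies. [cite: Neukirch2013, Part III §7 Thm. (7.7), (7.8), pp. 176–178]
[cite: CasselsFrohlichANT1967, Ch. VII §12 Key Lemma (PDF p. 239)] -/
theorem exists_cyclic_charHecke_of_pow_prime_eq_one (F : Type) [Field F] [NumberField F] (p : ℕ)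
    (hp : p.Prime)
    (hζ : ∃ ζ : F, IsPrimitiveRoot ζ p) (hcomplex : ∀ w : InfinitePlace F, w.IsComplex)
    (η : HeckeCharacter F) (hη : η ^ p = 1) :
    ∃ (L : IntermediateField F (AlgebraicClosure F)) (_ : FiniteDimensional F L)
      (_ : IsAbelianGalois F L) (_ : IsCyclic (L ≃ₐ[F] L)) (χ : (L ≃ₐ[F] L) →* ℂˣ),
      η = charHecke L χ artinReciprocity_character_holds := by
  classical
  obtain ⟨ζ, hζ⟩ := hζ
  have hn : 0 < p := hp.pos
  haveI : Algebra.IsAlgebraic ℚ (AlgebraicClosure F) := Algebra.IsAlgebraic.trans ℚ F _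
  set ι : AlgebraicClosure F →+* ℂ := (IsAlgClosed.lift (R := ℚ) (M := ℂ)
    (S := AlgebraicClosure F)).toRingHom with hι
  -- a suitable `T`
  obtain ⟨T₀, hT₀⟩ := exists_isAdmissible_superset F
  have hfo : η.IsFiniteOrder := isOfFinOrder_iff_pow_eq_one.mpr ⟨p, hn, hη⟩
  have hopen : {x : ideleGroup F | η x = 1} ∈ nhds (1 : ideleGroup F) :=
    hfo.isOpen_setOf_eq_one.mem_nhds (by simp)
  obtain ⟨S₁, hS₁⟩ := exists_unitIdelesOutside_subset F hopen
  have hp0 : (Ideal.span {((p : ℕ) : 𝓞 F)} : Ideal (𝓞 F)) ≠ ⊥ := by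
    rw [Ne, Ideal.span_singleton_eq_bot]
    exact Nat.cast_ne_zero.mpr hp.ne_zero
  have hfin : {v : HeightOneSpectrum (𝓞 F) | ((p : ℕ) : 𝓞 F) ∈ v.asIdeal}.Finite :=
    (Ideal.finite_factors hp0).subset fun v hv => Ideal.dvd_span_singleton.mpr hv
  set T : Finset (HeightOneSpectrum (𝓞 F)) := T₀ ∪ S₁ ∪ hfin.toFinset with hTdef
  have hT : IsAdmissible F T :=
    hT₀ T (Finset.subset_union_left.trans Finset.subset_union_left)
  have hTn : ∀ v : HeightOneSpectrum (𝓞 F), ((p : ℕ) : 𝓞 F) ∈ v.asIdeal → v ∈ T :=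
    fun v hv => Finset.mem_union_right _ (hfin.mem_toFinset.mpr hv)
  have hS₁T : S₁ ⊆ T := Finset.subset_union_right.trans Finset.subset_union_left
  -- `η` kills `W = Fˣ (𝕀^T)ᵖ U^T`
  have hηW : ∀ x ∈ principalIdeles F ⊔ ((sIdeles F T).map (powMonoidHom p) ⊔ unitIdelesOutside F T),
      η x = 1 := by
    intro x hx
    obtain ⟨q, hq, b, hb, rfl⟩ := Subgroup.mem_sup.mp hx
    obtain ⟨y, hy, u, hu, rfl⟩ := Subgroup.mem_sup.mp hb
    obtain ⟨z, -, rfl⟩ := Subgroup.mem_map.mp hy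
    have h1 : η q = 1 := η.map_principal hq
    have h2 : η (powMonoidHom p z) = 1 := by
      rw [powMonoidHom_apply, map_pow, ← HeckeCharacter.pow_apply, hη, HeckeCharacter.one_apply]
    have h3 : η u = 1 := hS₁ (unitIdelesOutside_antitone hS₁T hu)
    rw [map_mul, map_mul, h1, h2, h3, one_mul, one_mul]
  obtain ⟨a, ha, α, hα, χ, -, hηeq⟩ := exists_eq_charHecke_of_forall_mem_sup
    artinReciprocity_character_holds ι hn hζ hcomplex hT hTn η hηW
  haveI := KummerCharacter.finiteDimensional_adjoin hn hα
  haveI := KummerCharacter.isAbelianGalois ι hn hζ ha hα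
  exact ⟨F⟮α⟯, inferInstance, inferInstance, KummerCharacter.isCyclic ι hn hζ ha hα, χ, hηeq⟩

/-- **The global reciprocity map exists** (Artin reciprocity with the existence theorem: Neukirch
III (6.6) + (7.8)/(7.12); Tate, Cassels–Fröhlich VII 5.1): for every number field `K` (in the
universe `Type` of the tree's idele class group / absolute Galois group API) there is a continuous
surjection `θ : C_K → Gal(K^ab/K)` with the reciprocity properties `IsGlobalReciprocityMap`.
This discharges the named fact `exists_isGlobalReciprocityMap` (stated for `K : Type u`; all its
consumers, and the whole class-field-theory chain of this directory, live at `K : Type`).  Road: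
`exists_isGlobalReciprocityMap_of_keyLemma` (cyclic descent along `K(μ_{4p})/K`, Tate's order
induction) + the Key Lemma `exists_cyclic_charHecke_of_pow_prime_eq_one` (Kummer theory + the
idelic index computation of Neukirch (7.7)).
[cite: Neukirch2013, Part III §6 Thm. (6.6), §7 Thm. (7.7), (7.8), (7.12), pp. 176–182]
[cite: CasselsFrohlichANT1967, Ch. VII §5.1 Main Theorem, §12] -/
theorem exists_isGlobalReciprocityMap_holds (K : Type) [Field K] [NumberField K] :
    exists_isGlobalReciprocityMap K :=
  exists_isGlobalReciprocityMap_of_keyLemma exists_cyclic_charHecke_of_pow_prime_eq_one K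

end Literature.NumberTheory.GaloisRepresentations

end
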